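import Mathlib
import Literature.Analysis.FluidPDE.VectorCalculus
import Literature.Analysis.FluidPDE.LeiZhang2011Proofs
import Summits.NavierStokesRegularity.NavierStokesRegularity.Theorems.FilamentSkeletonRssSkeletonEquilibriumLineBiotSavart
import Summits.NavierStokesRegularity.NavierStokesRegularity.Theorems.FilamentSkeletonRssSelectionBoxRJRungPartnerLipschitz
import Summits.NavierStokesRegularity.NavierStokesRegularity.Theorems.FilamentSkeletonRssSelectionBoxRJRungModelArcSlip
import Summits.NavierStokesRegularity.NavierStokesRegularity.Theorems.FilamentSkeletonRssSelectionBoxRJRungModelArcConstants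

/-!
# Route `FilamentSkeletonRss` · crux `SelectionBoxRJ` (stmt-NavierStokesRegularity-21220) — rung tools (R2, brick 1):
# the TRUE partner field along a near-straight `R_π`-symmetric pair is `O(θ)√Γ`-close to the frozen rung-0 forcing

Lane `ns-filament-19175-p1` (g7); helper file `--supports stmt-NavierStokesRegularity-21220`, route-independent.

The model rung R1 (`…RungModelArc`) freezes the partner's field at its rung-0 values `U(t)` along the parameter; its zero
analysis (`…RungModelArcZero.slip_zero_package`) accepts any forcing `f` with `‖f − U‖ ≤ ε₀√Γ` (and `‖f′ − U′‖ ≤ ε₁`).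
This file supplies the `C⁰` half for the TRUE partner field: if `z` is a unit-speed `C¹` curve through the waist point
`P = (√Γ/5, 0, 0)` with `‖z′ − e‖ ≤ θ` on `ℝ` (`e = (0, 1/√2, 1/√2)`), and the partner is its `R_π`-image
`σ ↦ R_π(z σ)`, `R_π y = 2⟪y, e₃⟫e₃ − y`, then the partner's regularised Biot–Savart field (the box's `u`-kernel, core `1`,
circulation parameter `γ = 4`) evaluated AT THE MOVING POINT `z t`,
`f t = (Γ·4/(4π)) • ∫ ((‖z t − R_π z σ‖² + 1)^{3/2})⁻¹ • ((R_π ∘ z)′ σ × (z t − R_π z σ)) dσ`,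
satisfies `‖f t − U t‖ ≤ 28 θ √Γ` for all `t` (`θ ≤ 1/500`, `Γ > 0`).

Ingredients: `partner_integral_sub_le` — g6's two-filament kernel estimate `biotSavart_curveLipschitz` for the pair
(`R_π ∘ z`, straight partner line `ℓ₂ = R_π ∘ ℓ₁`) seen from `z t` (pivot form: `R_π z − ℓ₂ = R_π(z − ℓ₁)`, `‖·‖ ≤ θ|σ|`;
distances `≥ (1 − 2θ)(2/5)√Γ` and linear escape from `nearStraight_sep_rot` / `nearStraight_sep_line`); `lineField_two_point` —
an explicit two-point Lipschitz bound `6‖w − w′‖/m²` for the closed-form line field `(2/(‖w‖² + 1)) e₂ × w`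
(`stub_lineBiotSavart`) between points at distance `≥ m` from the line; and `U_eq_lineBiotSavart` (the frozen forcing IS the
line's field along `ℓ₁`).

HONEST FRAMING.  Kernel bookkeeping for the rung ladder of a HYPOTHETICAL filament box (the `C⁰` input `ε₀ = 28θ` of R2; the
`C¹` input `ε₁` needs a gradient version of the curve-Lipschitz estimate, not in the tree); nothing here is a claim about
Navier–Stokes regularity or blow-up.
-/

set_option linter.dupNamespace false -- `Theorems.…Theorems`-style path/namespace repetition is the tree convention

noncomputable section

namespace Summit.NavierStokesRegularity.NavierStokesRegularity.Theorems

open Set Function Filter MeasureTheory Real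
open Literature.Analysis.FluidPDE
open Summit.NavierStokesRegularity.NavierStokesRegularity.Theorems.SkeletonEquilibrium.Sketch
open scoped InnerProductSpace Topology

namespace SelectionBoxRJRung

/-! ### The rotation `R_π` about `e₃` -/

/-- `R_π(2⟪·,e₃⟫e₃ − ·)` acts on the rung-0 line as `R_π ℓ₁ σ = ℓ₂ σ = (−√Γ/5, 0, 0) + σ(0, −1/√2, 1/√2)`. [folklore] -/
theorem rotPi_line (Γ σ : ℝ) :
    (2 * ⟪(WithLp.toLp 2 ![Real.sqrt Γ / 5, 0, 0] : EuclideanSpace ℝ (Fin 3)) +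
        σ • WithLp.toLp 2 ![0, (Real.sqrt 2)⁻¹, (Real.sqrt 2)⁻¹], EuclideanSpace.single 2 1⟫_ℝ) •
        (EuclideanSpace.single (2 : Fin 3) (1 : ℝ)) -
      ((WithLp.toLp 2 ![Real.sqrt Γ / 5, 0, 0] : EuclideanSpace ℝ (Fin 3)) +
        σ • WithLp.toLp 2 ![0, (Real.sqrt 2)⁻¹, (Real.sqrt 2)⁻¹]) =
      (WithLp.toLp 2 ![-(Real.sqrt Γ / 5), 0, 0] : EuclideanSpace ℝ (Fin 3)) +
        σ • WithLp.toLp 2 ![0, -(Real.sqrt 2)⁻¹, (Real.sqrt 2)⁻¹] := by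
  rw [pt₁, single_two_eq_vec3, inner_vec3, smul_vec3, smul_vec3, sub_vec3, add_vec3]
  congr 1
  funext i
  fin_cases i
  · simp
  · simp
  · simp; ring

/-- `‖R_π a − R_π b‖ = ‖a − b‖` (linearity of `R_π` and `norm_rotPi`). [folklore] -/
theorem rotPi_sub_norm (a b : EuclideanSpace ℝ (Fin 3)) :
    ‖((2 * ⟪a, EuclideanSpace.single 2 1⟫_ℝ) • (EuclideanSpace.single (2 : Fin 3) (1 : ℝ)) - a) -
        ((2 * ⟪b, EuclideanSpace.single 2 1⟫_ℝ) • (EuclideanSpace.single (2 : Fin 3) (1 : ℝ)) - b)‖ = ‖a - b‖ := by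
  have : ((2 * ⟪a, EuclideanSpace.single 2 1⟫_ℝ) • (EuclideanSpace.single (2 : Fin 3) (1 : ℝ)) - a) -
      ((2 * ⟪b, EuclideanSpace.single 2 1⟫_ℝ) • (EuclideanSpace.single (2 : Fin 3) (1 : ℝ)) - b) =
      (2 * ⟪a - b, EuclideanSpace.single 2 1⟫_ℝ) • (EuclideanSpace.single (2 : Fin 3) (1 : ℝ)) - (a - b) := by
    rw [inner_sub_left, mul_sub, sub_smul]; abel
  rw [this, norm_rotPi]

/-! ### Separation of a near-straight curve from its `R_π`-image and from the partner line -/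

/-- **Near-straight curve vs its `R_π`-image.**  If `z` is differentiable with `z 0 = P` and `‖z′ − e‖ ≤ θ` on `ℝ`
(`0 ≤ θ ≤ 1/4`), then for all `τ, σ`: `‖z τ − R_π z σ‖ ≥ (1 − 2θ)·‖ℓ₁ τ − R_π ℓ₁ σ‖`, and the latter dominates
`(2/5)√Γ`, `|τ|` and `|σ|`. [folklore] -/
theorem nearStraight_sep_rot {Γ θ : ℝ} (hΓ : 0 < Γ) (hθ0 : 0 ≤ θ) (hθ1 : θ ≤ 1 / 4) {z : ℝ → EuclideanSpace ℝ (Fin 3)}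
    (hzd : Differentiable ℝ z) (hz0 : z 0 = WithLp.toLp 2 ![Real.sqrt Γ / 5, 0, 0])
    (hθ : ∀ s, ‖deriv z s - WithLp.toLp 2 ![0, (Real.sqrt 2)⁻¹, (Real.sqrt 2)⁻¹]‖ ≤ θ) (τ σ : ℝ) :
    (1 - 2 * θ) * (2 * Real.sqrt Γ / 5) ≤
        ‖z τ - ((2 * ⟪z σ, EuclideanSpace.single 2 1⟫_ℝ) • (EuclideanSpace.single (2 : Fin 3) (1 : ℝ)) - z σ)‖ ∧
      (1 - 2 * θ) * |σ| ≤
        ‖z τ - ((2 * ⟪z σ, EuclideanSpace.single 2 1⟫_ℝ) • (EuclideanSpace.single (2 : Fin 3) (1 : ℝ)) - z σ)‖ ∧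
      (1 - 2 * θ) * |τ| ≤
        ‖z τ - ((2 * ⟪z σ, EuclideanSpace.single 2 1⟫_ℝ) • (EuclideanSpace.single (2 : Fin 3) (1 : ℝ)) - z σ)‖ := by
  have hG : 0 < Real.sqrt Γ := Real.sqrt_pos.2 hΓ
  have hG2 : Real.sqrt Γ ^ 2 = Γ := Real.sq_sqrt hΓ.le
  have hdτ := arc_displacement_le hzd hz0 hθ τ
  have hdσ := arc_displacement_le hzd hz0 hθ σ
  have hN2 := norm_sq_line_sub_rot Γ τ σ hΓ.le
  obtain ⟨P, hP⟩ : ∃ P : EuclideanSpace ℝ (Fin 3), P = WithLp.toLp 2 ![Real.sqrt Γ / 5, 0, 0] := ⟨_, rfl⟩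
  obtain ⟨e, he⟩ : ∃ e : EuclideanSpace ℝ (Fin 3), e = WithLp.toLp 2 ![0, (Real.sqrt 2)⁻¹, (Real.sqrt 2)⁻¹] := ⟨_, rfl⟩
  obtain ⟨e₃, he₃⟩ : ∃ e₃ : EuclideanSpace ℝ (Fin 3), e₃ = EuclideanSpace.single (2 : Fin 3) (1 : ℝ) := ⟨_, rfl⟩
  rw [← hP, ← he] at hdτ hdσ hN2
  rw [← he₃] at hN2 ⊢
  have hN0 := norm_nonneg ((P + τ • e) - ((2 * ⟪P + σ • e, e₃⟫_ℝ) • e₃ - (P + σ • e)))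
  have hNG : 2 * Real.sqrt Γ / 5 ≤ ‖(P + τ • e) - ((2 * ⟪P + σ • e, e₃⟫_ℝ) • e₃ - (P + σ • e))‖ := by
    nlinarith [hN2, hG2, hG, sq_nonneg τ, sq_nonneg σ, hN0, mul_nonneg hN0 hG.le]
  have hNτ : |τ| ≤ ‖(P + τ • e) - ((2 * ⟪P + σ • e, e₃⟫_ℝ) • e₃ - (P + σ • e))‖ := by
    nlinarith [hN2, sq_abs τ, hΓ, sq_nonneg σ, abs_nonneg τ, hN0, mul_nonneg hN0 (abs_nonneg τ)]
  have hNσ : |σ| ≤ ‖(P + τ • e) - ((2 * ⟪P + σ • e, e₃⟫_ℝ) • e₃ - (P + σ • e))‖ := by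
    nlinarith [hN2, sq_abs σ, hΓ, sq_nonneg τ, abs_nonneg σ, hN0, mul_nonneg hN0 (abs_nonneg σ)]
  have hRlin : ∀ a b : EuclideanSpace ℝ (Fin 3),
      ((2 * ⟪a, e₃⟫_ℝ) • e₃ - a) - ((2 * ⟪b, e₃⟫_ℝ) • e₃ - b) = (2 * ⟪a - b, e₃⟫_ℝ) • e₃ - (a - b) := by
    intro a b; rw [inner_sub_left, mul_sub, sub_smul]; abel
  have hdec : z τ - ((2 * ⟪z σ, e₃⟫_ℝ) • e₃ - z σ) =
      ((P + τ • e) - ((2 * ⟪P + σ • e, e₃⟫_ℝ) • e₃ - (P + σ • e))) + (z τ - (P + τ • e)) -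
        ((2 * ⟪z σ - (P + σ • e), e₃⟫_ℝ) • e₃ - (z σ - (P + σ • e))) := by
    rw [← hRlin]; abel
  have hRn : ‖(2 * ⟪z σ - (P + σ • e), e₃⟫_ℝ) • e₃ - (z σ - (P + σ • e))‖ = ‖z σ - (P + σ • e)‖ := by
    rw [he₃]; exact norm_rotPi _
  have key : ∀ A B C : EuclideanSpace ℝ (Fin 3), ‖A‖ ≤ ‖A + B - C‖ + ‖B‖ + ‖C‖ := by
    intro A B C
    have e1 : A = (A + B - C) + (C - B) := by abel
    calc ‖A‖ = ‖(A + B - C) + (C - B)‖ := by rw [← e1]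
      _ ≤ ‖A + B - C‖ + ‖C - B‖ := norm_add_le _ _
      _ ≤ ‖A + B - C‖ + (‖C‖ + ‖B‖) := by gcongr; exact norm_sub_le _ _
      _ = ‖A + B - C‖ + ‖B‖ + ‖C‖ := by ring
  have hk := key ((P + τ • e) - ((2 * ⟪P + σ • e, e₃⟫_ℝ) • e₃ - (P + σ • e))) (z τ - (P + τ • e))
    ((2 * ⟪z σ - (P + σ • e), e₃⟫_ℝ) • e₃ - (z σ - (P + σ • e)))
  rw [← hdec, hRn] at hk
  have h1 := mul_le_mul_of_nonneg_left hNτ hθ0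
  have h2 := mul_le_mul_of_nonneg_left hNσ hθ0
  have hW : (1 - 2 * θ) * ‖(P + τ • e) - ((2 * ⟪P + σ • e, e₃⟫_ℝ) • e₃ - (P + σ • e))‖ ≤
      ‖z τ - ((2 * ⟪z σ, e₃⟫_ℝ) • e₃ - z σ)‖ := by linarith
  have h12 : 0 ≤ 1 - 2 * θ := by linarith
  exact ⟨(mul_le_mul_of_nonneg_left hNG h12).trans hW, (mul_le_mul_of_nonneg_left hNσ h12).trans hW,
    (mul_le_mul_of_nonneg_left hNτ h12).trans hW⟩

/-- **Near-straight curve vs the partner LINE.**  Under the same hypotheses, for all `τ, σ`: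
`‖z τ − ℓ₂ σ‖ ≥ (1 − θ)‖ℓ₁ τ − ℓ₂ σ‖`, which dominates `(2/5)√Γ` and `|σ|` (`ℓ₂ = R_π ℓ₁`). [folklore] -/
theorem nearStraight_sep_line {Γ θ : ℝ} (hΓ : 0 < Γ) (hθ0 : 0 ≤ θ) (hθ1 : θ ≤ 1 / 4) {z : ℝ → EuclideanSpace ℝ (Fin 3)}
    (hzd : Differentiable ℝ z) (hz0 : z 0 = WithLp.toLp 2 ![Real.sqrt Γ / 5, 0, 0])
    (hθ : ∀ s, ‖deriv z s - WithLp.toLp 2 ![0, (Real.sqrt 2)⁻¹, (Real.sqrt 2)⁻¹]‖ ≤ θ) (τ σ : ℝ) :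
    (1 - θ) * (2 * Real.sqrt Γ / 5) ≤
        ‖z τ - ((WithLp.toLp 2 ![-(Real.sqrt Γ / 5), 0, 0] : EuclideanSpace ℝ (Fin 3)) +
          σ • WithLp.toLp 2 ![0, -(Real.sqrt 2)⁻¹, (Real.sqrt 2)⁻¹])‖ ∧
      (1 - θ) * |σ| ≤
        ‖z τ - ((WithLp.toLp 2 ![-(Real.sqrt Γ / 5), 0, 0] : EuclideanSpace ℝ (Fin 3)) +
          σ • WithLp.toLp 2 ![0, -(Real.sqrt 2)⁻¹, (Real.sqrt 2)⁻¹])‖ := by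
  have hG : 0 < Real.sqrt Γ := Real.sqrt_pos.2 hΓ
  have hG2 : Real.sqrt Γ ^ 2 = Γ := Real.sq_sqrt hΓ.le
  have hdτ := arc_displacement_le hzd hz0 hθ τ
  have hN2 := norm_sq_line_sub_rot Γ τ σ hΓ.le
  rw [rotPi_line] at hN2
  set L := ((WithLp.toLp 2 ![-(Real.sqrt Γ / 5), 0, 0] : EuclideanSpace ℝ (Fin 3)) +
          σ • WithLp.toLp 2 ![0, -(Real.sqrt 2)⁻¹, (Real.sqrt 2)⁻¹]) with hLdef
  set ℓ := ((WithLp.toLp 2 ![Real.sqrt Γ / 5, 0, 0] : EuclideanSpace ℝ (Fin 3)) +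
        τ • WithLp.toLp 2 ![0, (Real.sqrt 2)⁻¹, (Real.sqrt 2)⁻¹]) with hℓdef
  have hN0 := norm_nonneg (ℓ - L)
  have hNG : 2 * Real.sqrt Γ / 5 ≤ ‖ℓ - L‖ := by
    nlinarith [hN2, hG2, hG, sq_nonneg τ, sq_nonneg σ, hN0, mul_nonneg hN0 hG.le]
  have hNτ : |τ| ≤ ‖ℓ - L‖ := by
    nlinarith [hN2, sq_abs τ, hΓ, sq_nonneg σ, abs_nonneg τ, hN0, mul_nonneg hN0 (abs_nonneg τ)]
  have hNσ : |σ| ≤ ‖ℓ - L‖ := by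
    nlinarith [hN2, sq_abs σ, hΓ, sq_nonneg τ, abs_nonneg σ, hN0, mul_nonneg hN0 (abs_nonneg σ)]
  have htri : ‖ℓ - L‖ - ‖z τ - ℓ‖ ≤ ‖z τ - L‖ := by
    have := norm_sub_le_norm_sub_add_norm_sub ℓ (z τ) L
    rw [norm_sub_rev ℓ (z τ)] at this
    linarith
  have h1 := mul_le_mul_of_nonneg_left hNτ hθ0
  have hW : (1 - θ) * ‖ℓ - L‖ ≤ ‖z τ - L‖ := by linarith
  have h11 : 0 ≤ 1 - θ := by linarith
  exact ⟨(mul_le_mul_of_nonneg_left hNG h11).trans hW, (mul_le_mul_of_nonneg_left hNσ h11).trans hW⟩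


/-! ### The closed-form line field and its two-point Lipschitz bound -/

/-- `e × (v − s e) = e × v`. [folklore] -/
theorem cross_sub_smul_self' (e v : EuclideanSpace ℝ (Fin 3)) (s : ℝ) : cross e (v - s • e) = cross e v := by
  rw [← crossCLM_apply, map_sub, map_smul, crossCLM_apply, crossCLM_apply]
  have : cross e e = 0 := by simp [cross]
  rw [this, smul_zero, sub_zero]

/-- Pythagoras for the component orthogonal to a unit vector: `‖v − ⟪v,e⟫e‖² = ‖v‖² − ⟪v,e⟫²`. [folklore] -/
theorem norm_sq_sub_inner_smul (e v : EuclideanSpace ℝ (Fin 3)) (he : ‖e‖ = 1) :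
    ‖v - ⟪v, e⟫_ℝ • e‖ ^ 2 = ‖v‖ ^ 2 - ⟪v, e⟫_ℝ ^ 2 := by
  rw [norm_sub_sq_real, norm_smul, he, mul_one, inner_smul_right, Real.norm_eq_abs, sq_abs]
  ring

/-- The orthogonal projection off a unit vector is `1`-Lipschitz:
`‖(v − ⟪v,e⟫e) − (v′ − ⟪v′,e⟫e)‖ ≤ ‖v − v′‖`. [folklore] -/
theorem norm_proj_sub_le (e v v' : EuclideanSpace ℝ (Fin 3)) (he : ‖e‖ = 1) :
    ‖(v - ⟪v, e⟫_ℝ • e) - (v' - ⟪v', e⟫_ℝ • e)‖ ≤ ‖v - v'‖ := by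
  have h : (v - ⟪v, e⟫_ℝ • e) - (v' - ⟪v', e⟫_ℝ • e) = (v - v') - ⟪v - v', e⟫_ℝ • e := by
    rw [inner_sub_left, sub_smul]; abel
  rw [h]
  have hsq := norm_sq_sub_inner_smul e (v - v') he
  have h1 : ‖(v - v') - ⟪v - v', e⟫_ℝ • e‖ ^ 2 ≤ ‖v - v'‖ ^ 2 := by rw [hsq]; nlinarith [sq_nonneg ⟪v - v', e⟫_ℝ]
  exact (abs_le_of_sq_le_sq' h1 (norm_nonneg _)).2

/-- **Two-point Lipschitz bound for the closed-form line field.**  For a unit vector `e` and `w, w′` with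
`‖w‖, ‖w′‖ ≥ m > 0`: `‖(2/(‖w‖²+1)) e × w − (2/(‖w′‖²+1)) e × w′‖ ≤ 6‖w − w′‖/m²`. [folklore] -/
theorem lineField_two_point (e : EuclideanSpace ℝ (Fin 3)) (he : ‖e‖ = 1) {w w' : EuclideanSpace ℝ (Fin 3)} {m : ℝ}
    (hm : 0 < m) (hw : m ≤ ‖w‖) (hw' : m ≤ ‖w'‖) :
    ‖(2 / (‖w‖ ^ 2 + 1)) • cross e w - (2 / (‖w'‖ ^ 2 + 1)) • cross e w'‖ ≤ 6 * ‖w - w'‖ / m ^ 2 := by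
  set a := ‖w‖ with ha
  set b := ‖w'‖ with hb
  set d := ‖w - w'‖ with hd
  have ha0 : 0 < a := hm.trans_le hw
  have hb0 : 0 < b := hm.trans_le hw'
  have hd0 : 0 ≤ d := norm_nonneg _
  have hA : 0 < a ^ 2 + 1 := by positivity
  have hB : 0 < b ^ 2 + 1 := by positivity
  -- decomposition
  have hdec : (2 / (a ^ 2 + 1)) • cross e w - (2 / (b ^ 2 + 1)) • cross e w' =
      (2 / (a ^ 2 + 1)) • cross e (w - w') + (2 / (a ^ 2 + 1) - 2 / (b ^ 2 + 1)) • cross e w' := by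
    rw [← crossCLM_apply, ← crossCLM_apply, ← crossCLM_apply, map_sub, smul_sub, sub_smul]; abel
  rw [hdec]
  have hcross1 : ‖cross e (w - w')‖ ≤ d := by
    have := norm_cross_le_norm_mul_norm e (w - w'); rwa [he, one_mul] at this
  have hcross2 : ‖cross e w'‖ ≤ b := by
    have := norm_cross_le_norm_mul_norm e w'; rwa [he, one_mul] at this
  have hab : |a - b| ≤ d := by
    have := abs_norm_sub_norm_le w w'; rwa [← ha, ← hb, ← hd] at this
  -- first term
  have h1 : ‖(2 / (a ^ 2 + 1)) • cross e (w - w')‖ ≤ 2 * d / m ^ 2 := by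
    rw [norm_smul, Real.norm_eq_abs, abs_of_pos (by positivity)]
    calc 2 / (a ^ 2 + 1) * ‖cross e (w - w')‖ ≤ 2 / (a ^ 2 + 1) * d :=
          mul_le_mul_of_nonneg_left hcross1 (by positivity)
      _ ≤ 2 / m ^ 2 * d := by
          refine mul_le_mul_of_nonneg_right ?_ hd0
          exact div_le_div_of_nonneg_left (by norm_num) (by positivity) (by nlinarith)
      _ = 2 * d / m ^ 2 := by ring
  -- second term
  have hcoef : |2 / (a ^ 2 + 1) - 2 / (b ^ 2 + 1)| ≤ 2 * d * (a + b) / ((a ^ 2 + 1) * (b ^ 2 + 1)) := by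
    have : 2 / (a ^ 2 + 1) - 2 / (b ^ 2 + 1) = 2 * ((b - a) * (b + a)) / ((a ^ 2 + 1) * (b ^ 2 + 1)) := by
      field_simp; ring
    rw [this, abs_div, abs_of_pos (by positivity : (0:ℝ) < (a ^ 2 + 1) * (b ^ 2 + 1)), abs_mul,
      abs_of_pos (by norm_num : (0:ℝ) < 2), abs_mul, abs_of_pos (by linarith : 0 < b + a)]
    refine div_le_div_of_nonneg_right ?_ (by positivity)
    rw [abs_sub_comm] at hab
    nlinarith [hab, mul_le_mul_of_nonneg_right hab (by linarith : 0 ≤ b + a)]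
  have h2 : ‖(2 / (a ^ 2 + 1) - 2 / (b ^ 2 + 1)) • cross e w'‖ ≤ 4 * d / m ^ 2 := by
    rw [norm_smul, Real.norm_eq_abs]
    calc |2 / (a ^ 2 + 1) - 2 / (b ^ 2 + 1)| * ‖cross e w'‖
        ≤ 2 * d * (a + b) / ((a ^ 2 + 1) * (b ^ 2 + 1)) * b :=
          mul_le_mul hcoef hcross2 (norm_nonneg _) (by positivity)
      _ ≤ 4 * d / m ^ 2 := by
          rw [div_mul_eq_mul_div, div_le_div_iff₀ (by positivity) (by positivity)]
          -- `2 d (a + b) b m² ≤ 4 d (a²+1)(b²+1)`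
          have hm2a : m ^ 2 ≤ a * b := by nlinarith
          have hm2b : m ^ 2 ≤ a ^ 2 := by nlinarith
          have hk1 : a * b * m ^ 2 ≤ (a ^ 2 + 1) * (b ^ 2 + 1) := by nlinarith [mul_nonneg ha0.le hb0.le]
          have hk2 : b ^ 2 * m ^ 2 ≤ (a ^ 2 + 1) * (b ^ 2 + 1) := by nlinarith [sq_nonneg b]
          nlinarith [hk1, hk2, hd0, mul_nonneg hd0 (by positivity : (0:ℝ) ≤ (a ^ 2 + 1) * (b ^ 2 + 1))]
  calc ‖(2 / (a ^ 2 + 1)) • cross e (w - w') + (2 / (a ^ 2 + 1) - 2 / (b ^ 2 + 1)) • cross e w'‖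
      ≤ ‖(2 / (a ^ 2 + 1)) • cross e (w - w')‖ + ‖(2 / (a ^ 2 + 1) - 2 / (b ^ 2 + 1)) • cross e w'‖ :=
        norm_add_le _ _
    _ ≤ 2 * d / m ^ 2 + 4 * d / m ^ 2 := add_le_add h1 h2
    _ = 6 * d / m ^ 2 := by ring

/-- **The straight partner's field in projected form.**  For the line `σ ↦ Q + σ e₂` (`‖e₂‖ = 1`) and any point `y`,
with `w = (y − Q) − ⟪y − Q, e₂⟫e₂` the component of `y − Q` orthogonal to the line:
`∫ ((‖y − (Q + σe₂)‖² + 1)^{3/2})⁻¹ • e₂ × (y − (Q + σe₂)) dσ = (2/(‖w‖² + 1)) • e₂ × w` (`stub_lineBiotSavart`). [folklore] -/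
theorem lineField_proj (Q e₂ y : EuclideanSpace ℝ (Fin 3)) (he : ‖e₂‖ = 1) :
    ∫ σ : ℝ, ((‖y - (Q + σ • e₂)‖ ^ 2 + 1) ^ (3 / 2 : ℝ))⁻¹ • cross e₂ (y - (Q + σ • e₂)) =
      (2 / (‖(y - Q) - ⟪y - Q, e₂⟫_ℝ • e₂‖ ^ 2 + 1)) • cross e₂ ((y - Q) - ⟪y - Q, e₂⟫_ℝ • e₂) := by
  rw [(stub_lineBiotSavart Q e₂ y he).2, norm_sq_sub_inner_smul e₂ (y - Q) he, cross_sub_smul_self']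

/-- **The frozen forcing IS the straight partner's field along the rung-0 line:**
`U t = (Γ·4/(4π)) • ∫ ((‖ℓ₁ t − ℓ₂ σ‖² + 1)^{3/2})⁻¹ • ℓ₂′ × (ℓ₁ t − ℓ₂ σ) dσ` with `ℓ₂ σ = (−√Γ/5, 0, 0) + σ(0, −1/√2, 1/√2)`
— the `k = 1` summand of the box's `u`-formula for the straight pair at the point `ℓ₁ t`. [folklore] -/
theorem U_eq_lineBiotSavart {Γ : ℝ} (hΓ : 0 ≤ Γ) (U : ℝ → EuclideanSpace ℝ (Fin 3))
    (hU : ∀ t, U t = (2 * Γ / Real.pi / (4 * Γ / 25 + 1 + t ^ 2)) •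
      ((2 * Real.sqrt Γ / 5) • (WithLp.toLp 2 ![0, (Real.sqrt 2)⁻¹, (Real.sqrt 2)⁻¹] : EuclideanSpace ℝ (Fin 3)) -
        t • WithLp.toLp 2 ![(1:ℝ), 0, 0])) (t : ℝ) :
    U t = (Γ * 4 / (4 * Real.pi)) • ∫ σ : ℝ,
      ((‖((WithLp.toLp 2 ![Real.sqrt Γ / 5, 0, 0] : EuclideanSpace ℝ (Fin 3)) +
            t • WithLp.toLp 2 ![0, (Real.sqrt 2)⁻¹, (Real.sqrt 2)⁻¹]) -
          ((WithLp.toLp 2 ![-(Real.sqrt Γ / 5), 0, 0] : EuclideanSpace ℝ (Fin 3)) +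
            σ • WithLp.toLp 2 ![0, -(Real.sqrt 2)⁻¹, (Real.sqrt 2)⁻¹])‖ ^ 2 + 1) ^ (3 / 2 : ℝ))⁻¹ •
        cross (WithLp.toLp 2 ![0, -(Real.sqrt 2)⁻¹, (Real.sqrt 2)⁻¹])
          (((WithLp.toLp 2 ![Real.sqrt Γ / 5, 0, 0] : EuclideanSpace ℝ (Fin 3)) +
              t • WithLp.toLp 2 ![0, (Real.sqrt 2)⁻¹, (Real.sqrt 2)⁻¹]) -
            ((WithLp.toLp 2 ![-(Real.sqrt Γ / 5), 0, 0] : EuclideanSpace ℝ (Fin 3)) +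
              σ • WithLp.toLp 2 ![0, -(Real.sqrt 2)⁻¹, (Real.sqrt 2)⁻¹])) := by
  have hs := inv_sqrt_two_mul_self
  have hG : Real.sqrt Γ * Real.sqrt Γ = Γ := Real.mul_self_sqrt hΓ
  rw [(stub_lineBiotSavart _ _ _ norm_tangent₂).2, pt₁_sub_P₂, inner_vec3, cross_vec3,
    VortexFilament.norm_sq_toLp_three, hU t, smul_vec3, smul_vec3, sub_vec3, smul_smul]
  have hD : 4 * Γ / 25 + 1 + t ^ 2 ≠ 0 := by positivity
  have hden : (2 * Real.sqrt Γ / 5) ^ 2 + (t * (Real.sqrt 2)⁻¹) ^ 2 + (t * (Real.sqrt 2)⁻¹) ^ 2 -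
      (2 * Real.sqrt Γ / 5 * 0 + t * (Real.sqrt 2)⁻¹ * -(Real.sqrt 2)⁻¹ + t * (Real.sqrt 2)⁻¹ * (Real.sqrt 2)⁻¹) ^ 2 + 1 =
      4 * Γ / 25 + 1 + t ^ 2 := by
    linear_combination (4 / 25) * hG + (2 * t ^ 2) * hs
  rw [hden]
  have hcoef : Γ * 4 / (4 * Real.pi) * (2 / (4 * Γ / 25 + 1 + t ^ 2)) = 2 * Γ / Real.pi / (4 * Γ / 25 + 1 + t ^ 2) := by
    field_simp
  have hvec : (WithLp.toLp 2 ![-(Real.sqrt 2)⁻¹ * (t * (Real.sqrt 2)⁻¹) - (Real.sqrt 2)⁻¹ * (t * (Real.sqrt 2)⁻¹),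
      (Real.sqrt 2)⁻¹ * (2 * Real.sqrt Γ / 5) - 0 * (t * (Real.sqrt 2)⁻¹),
      0 * (t * (Real.sqrt 2)⁻¹) - -(Real.sqrt 2)⁻¹ * (2 * Real.sqrt Γ / 5)] : EuclideanSpace ℝ (Fin 3)) =
      WithLp.toLp 2 ![2 * Real.sqrt Γ / 5 * 0 - t * 1, 2 * Real.sqrt Γ / 5 * (Real.sqrt 2)⁻¹ - t * 0,
        2 * Real.sqrt Γ / 5 * (Real.sqrt 2)⁻¹ - t * 0] := by
    congr 1
    funext i
    fin_cases i
    · simp only [Fin.zero_eta, Matrix.cons_val_zero]; linear_combination (-(2:ℝ) * t) * hs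
    · simp only [Fin.mk_one, Matrix.cons_val_one, Matrix.cons_val_zero]; ring
    · simp only [Fin.reduceFinMk, Matrix.cons_val]; ring
  rw [hcoef, hvec]

end SelectionBoxRJRung

end Summit.NavierStokesRegularity.NavierStokesRegularity.Theorems
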